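import Summits.RiemannHypothesis.RiemannHypothesis.Theses.UniversalFactor
import Literature.NumberTheory.LFunctions.DeBruijnHDiv
import Literature.NumberTheory.LFunctions.DeBruijnNewmanConstProofs
import Summits.RiemannHypothesis.RiemannHypothesis.Theorems.UniversalFactorLaguerreLift

/-!
# Disproof of `NarrowKernelNoGo` (stmt-RiemannHypothesis-2576, route `UniversalFactor`) — findings

Crux (rank 2): `∀ a ≥ 32, ¬ HasOnlyRealZeros F_a`, where
`F_a(z) = ∫₀^∞ Φ(u)/(1 + u²/a²) cos(zu) du = deBruijnHDiv (1 + u²/a²) z` (by `rfl`,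
`Literature.NumberTheory.LFunctions.deBruijnHDiv_laplace_eq`) is the Laplace(a)-smoothing
`E[H_0(· + Y)]` of `H_0(z) = ξ(1/2 + iz/2)/8`.

Standing adversary: refuter-cdisprove-stmt-RiemannHypothesis-2576-0 (2026-08-15). Index of findings:

* (R) RESISTANCE, UNCONDITIONAL. `riemannHypothesis_of_not_crux : ¬ NarrowKernelNoGo → RH`:
  any disproof of the crux is a proof of RH, by the route's support item `LaguerreLift`, which is
  PROVED in the tree (`Theorems.UniversalFactor.laguerreLift`, Laguerre's theorem for `1 − D²/a²`,
  Hadamard-free) and `riemannHypothesis_iff_hasOnlyRealZeros_deBruijnH_zero_holds` (PROVED).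
  Conversely `crux_of_not_riemannHypothesis`: if RH fails the crux holds outright, so provers may
  assume RH (`crux_iff_rh_imp`, `crux_of_forall_not_and`): the content of the crux is exactly
  "RH ⇒ for every a ≥ 32 the Laplace(a)-smoothing of Ξ has a non-real zero" (generalised Newman on
  the Laplace ray). No refutation short of proving RH exists; none was found (numerics in (N)).
* (L) LOAD-BEARING analysis of the single hypothesis `32 ≤ a`: `F_neg` (only `a²` enters),
  `F_zero` (Lean junk `u²/0² = 0`: `F_0 = H_0`), so the threshold-free variant
  `NarrowKernelNoGoWithoutThreshold` has the `a = 0` instance `¬ RH` and its NEGATION is literally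
  equivalent to RH (`not_withoutThreshold_iff_riemannHypothesis`): the usual
  `_false_without_` theorem is unavailable in BOTH directions (it would decide RH). Any positive
  threshold `A` gives a statement between GN-on-the-Laplace-ray (`A → 0⁺`, = Wide+Medium+Narrow) and the
  crux (`from_mono`); 32 itself is a hand-off constant with the certified-computation item
  `MediumKernelNoGo` (π/8 ≤ a ≤ 32), not a natural boundary (`crux_iff_from`).
* (F) FAITHFULNESS of the formal statement: `F_apply_zero_re_pos`/`F_apply_zero_ne_zero`:
  `F_a(0) = ∫₀^∞ Φ/(1+u²/a²) > 0`, so `F_a ≢ 0` and `¬ HasOnlyRealZeros F_a` can never hold for the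
  junk reason "the zero function has non-real zeros"; the integrand is integrable for every `z`
  (`IsDivAdmissible.integrableOn_deBruijnHDiv`), `F_a` is entire
  (`differentiable_deBruijnHDiv_laplace`), even (`deBruijnHDiv_neg`), real on `ℝ`
  (`deBruijnHDiv_ofReal_im`) and `conj`-symmetric (`conj_deBruijnHDiv`); hence a non-real zero may
  be sought WLOG in the open upper half-plane with `Re z ≥ 0` (`not_hasOnlyRealZeros_F_iff`);
  (F') `F_apply_I_mul_re_pos`: `F_a(iy) = ∫₀^∞ Φ cosh(yu)/(1+u²/a²) > 0`, no zeros on the imaginary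
  axis, so WLOG the OPEN first quadrant (`not_hasOnlyRealZeros_F_iff'`).
* (P) POSITIVE HELPER (evidence for provers): `continuousAt_F_uncurry` — `(a, z) ↦ F_a(z)` is jointly
  continuous off `a = 0`, the input of the `a`-continuity/Hurwitz certificates on finite `a`-windows.
* (N) NUMERICS (local double-precision Euler–Maclaurin ζ / Stirling log Γ, cross-checked two ways;
  files local/stage*.py + NUMERICS.md on the item; the citable mpmath rerun is kit job j004873, queued).
  (N1) Lehmer pair γ = 7005.0628662/7005.1005647 (γ-gap 0.0376985, Z-bump +3.967e-3 at t = 7005.08175):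
  the two real zeros of `F_a` near `x = 2t = 14010.16` exist iff `a > a* = 37.473` (bisection on sign
  changes of `g_a(t) = −F_a(2t)/B(t)`; quadratic model `√2/gap = 37.514`). For `a < a*` they are the complex
  pair `x = 14010.163428 ± 0.022965 i` at `a = 32` (`|F/B| = 2e-13`, Muller on `E[H_0(z+Y)]` with `H_0` at
  complex points — independent of the real-axis convolution, which predicted `± 0.0230 i`),
  `± 0.010892 i` at `a = 36`, `± 0.079745 i` at `a = 16`. So the crux HOLDS numerically on `[32, 37.47)`
  through Lehmer's pair, and independently at `a = 32` through the lower pair 5229.198557/5229.241811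
  (gap 0.0432541, `a* = 32.70`): `F_32(10458.440644 + 0.008775 i) = 0` (`|F/B| = 2e-13`).
  (N2) Coverage beyond 37.47 (Riemann–Siegel scan `t ≤ 6·10⁴`, pairs refined by E–M ζ): closest pairs and
  `a* = √2/gap`: 57273.661932/.687771 → 54.73; 36510.166385/.195923 → 47.88; 50965.866871/.899782 → 42.97;
  56646.914296/.948648 → 41.17; 17143.786536/.821844 → 40.05; 33179.365294/.401575 → 38.98; confirmed
  complex zeros `F_38(34287.608803 + 0.011569 i)`, `F_45(73020.362648 + 0.010655 i)`,
  `F_50(114547.349850 + 0.011437 i)`, `F_54(114547.349829 + 0.004116 i)` (`|F/B| ≤ 2e-12`); i.e. every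
  `a ∈ [32, 54.7)` has a witnessing close pair below `6·10⁴` (one pair, 57273.66, serves all of `[5, 54.7)` in
  the quadratic model), and `a ≥ 54.7` needs `T > 6·10⁴` (j004873 part B scans to `2·10⁵`). No finite table
  reaches `a → ∞`: under GUE statistics the lowest witness for `a` sits at height `T` with
  `N(T)·(√2 log(T/2π)/(2πa))³ ≍ 1`.
  (N3) MECHANISM TEST (band-limit sign-change deficit, the proposed proof of the crux): on `t ∈ [2000, 2200]`
  (`Z` has 185 sign changes = N(2200) − N(2000)), `F_a` has 39 (a = 0.6), 57 (0.8), 77 (1.0), 117 (1.5),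
  145 (2), 177 (3), 183 (4), 185 (8). The deficit is REAL and sets in far BELOW the docstring's onset
  `t ≍ 2π e^{4a}` (a = 2: 22 % deficit at t = 2100 ≪ 18730; a = 3: 4 % at 2100 ≪ 10⁶): empirically the
  ratio depends on `a/L`, `L = ¼ log(t/2π) = 1.45`, and is < 1 as soon as `a/L ≲ 3`; a second height
  `t ∈ [20000, 20250]` (`L = 2.02`, 322 zeros) gives, at the same values of `a/L` (0.41, 0.69, 1.03, 1.38,
  2.07, 2.76), the ratios 0.239, 0.469, 0.640, 0.789, 0.907, 0.938 — the surviving fraction is a function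
  of `a/L` to first order. This SUPPORTS the crux's mechanism (height scale for an `ε`-deficit at `a = 32`:
  `L ≍ 32/3`, i.e. `t ≍ 10^{19}`, not `2πe^{128}`), it does not threaten the statement.
  (N4) ONE-POINT REAL-AXIS CERTIFICATE (lever of crux idea `laguerre-riccati-defect`, checked here numerically):
  LP(`F_a`) ⇒ Laguerre `(F_a')² − F_a F_a'' ≥ 0` on ℝ, and the tree's exact ODE `F_a'' = a²(F_a − H_0)`
  (`deBruijnHDiv_laplace_sub_deriv_deriv`) turns it into `L₁ := (F_a')² − a²F_a² + a²F_a H_0 ≥ 0`. At the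
  Lehmer dip `x_d = 14010.1635`, in units of `B(t_d)²`: `L₁ = −9.65e-2 (a=16), −8.17e-3 (32), −1.84e-3 (36),
  −5.67e-4 (37), +6.07e-4 (38), +2.70e-3 (40), +1.45e-2 (64)` — negative exactly for `a < a* = 37.47`
  (pieces at a = 32: `F/B = +1.468e-3, F'/B = +4.03e-4, H_0/B = −3.967e-3`). So `crux_at_32` (and
  `LehmerPointNoGo`) need only interval values of `F_a, F_a', H_0` at ONE real point plus the M-size lemma
  "LP ⇒ L₁ ≥ 0" (Hadamard-free via `exists_logDeriv_eq_sum_add_small_im`), not a complex box.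
  (N0) The chain "crux integrand = Laplace(a)-smoothing of `H_0 = ξ(1/2+ix/2)/8`" used by all numerics is
  verified to `1e-9` at `(x,a) ∈ {(10,2),(25,1),(3,32),(40,4)}` against direct quadrature of
  `∫₀^∞ Φ(u)/(1+u²/a²)cos(xu)du` with the tree's RT kernel.
* (S) NATURAL STRENGTHENINGS considered: uniform-in-`a` non-real zero in a fixed disc (expected
  FALSE by Hurwitz as `a → ∞`, but a Lean refutation needs certified simplicity of the low zeros of
  Ξ — not attempted); "`F_a` has no real zeros" (FALSE numerically, certificate-level only);
  threshold `0 < a` (= GN on the whole Laplace ray, expected TRUE); threshold `0 ≤ a` (contains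
  `¬RH`, see (L)). None is refutable in Lean today; recorded, not filed.

Everything below is `sorry`-free except the clearly marked near-miss section (N).
-/

noncomputable section

open Complex MeasureTheory Set
open scoped ComplexConjugate

namespace Summit.RiemannHypothesis.RiemannHypothesis.Cruxes.NarrowKernelNoGo.Disproof

open Literature.NumberTheory.LFunctions
open Summit.RiemannHypothesis.RiemannHypothesis.Theses.UniversalFactor

/-- The Laplace(a)-smoothed transform `F_a = deBruijnHDiv (1 + u²/a²)`; the crux's inlined integral
is `F a z` by `rfl`. [folklore] -/
abbrev F (a : ℝ) : ℂ → ℂ := deBruijnHDiv fun u : ℝ => 1 + u ^ 2 / a ^ 2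

/-- The crux restated through `F` (syntactic). [folklore] -/
theorem crux_iff : NarrowKernelNoGo ↔ ∀ a : ℝ, 32 ≤ a → ¬ HasOnlyRealZeros (F a) := Iff.rfl

/-- `LaguerreLift` restated through `F` (syntactic). [folklore] -/
theorem laguerreLift_iff :
    LaguerreLift ↔ ∀ a : ℝ, 0 < a → HasOnlyRealZeros (F a) → HasOnlyRealZeros (deBruijnH 0) :=
  Iff.rfl

/-! ## (R) Resistance: a disproof of the crux is a proof of RH -/

/-- `¬ crux ↔ some F_a, a ≥ 32, has only real zeros`. [folklore] -/
theorem not_crux_iff : ¬ NarrowKernelNoGo ↔ ∃ a : ℝ, 32 ≤ a ∧ HasOnlyRealZeros (F a) := by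
  rw [crux_iff]; push Not; rfl

/-- **Why it resists (unconditional).** Any disproof of the crux proves the Riemann hypothesis:
`(1 − D²/a²)F_a = H_0` (`deBruijnHDiv_laplace_sub_deriv_deriv`) and Laguerre's theorem (the route item
`LaguerreLift`, PROVED as `Theorems.UniversalFactor.laguerreLift`) lift real-rootedness from `F_a`
to `H_0 = ξ(1/2 + iz/2)/8`, which is RH (`riemannHypothesis_iff_hasOnlyRealZeros_deBruijnH_zero_holds`,
PROVED). [folklore] -/
theorem riemannHypothesis_of_not_crux (h : ¬ NarrowKernelNoGo) : RiemannHypothesis := by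
  obtain ⟨a, ha, hF⟩ := not_crux_iff.1 h
  exact riemannHypothesis_iff_hasOnlyRealZeros_deBruijnH_zero_holds.2
    (Theorems.UniversalFactor.laguerreLift a (by linarith) hF)

/-- Contrapositive: if RH is false the crux holds outright (for every `a > 0`, indeed). [folklore] -/
theorem crux_of_not_riemannHypothesis (h : ¬ RiemannHypothesis) : NarrowKernelNoGo := by
  by_contra hc
  exact h (riemannHypothesis_of_not_crux hc)

/-- WLOG RH: the crux is equivalent to its RH-conditional form. [folklore] -/
theorem crux_iff_rh_imp : NarrowKernelNoGo ↔ (RiemannHypothesis → NarrowKernelNoGo) := by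
  refine ⟨fun h _ => h, fun h => ?_⟩
  by_cases hR : RiemannHypothesis
  · exact h hR
  · exact crux_of_not_riemannHypothesis hR

/-- The provers' actual task, per `a`: refute the conjunction "`F_a` AND `H_0` have only real
zeros" (all zeros of Ξ may be taken real). [folklore] -/
theorem crux_of_forall_not_and
    (h : ∀ a : ℝ, 32 ≤ a → HasOnlyRealZeros (F a) → HasOnlyRealZeros (deBruijnH 0) → False) :
    NarrowKernelNoGo :=
  fun a ha hF => h a ha hF (Theorems.UniversalFactor.laguerreLift a (by linarith) hF)

/-! ## (L) Load-bearing analysis of the hypothesis `32 ≤ a` -/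

/-- Only `a²` enters: `F_{−a} = F_a`. [folklore] -/
theorem F_neg (a : ℝ) : F (-a) = F a := by
  simp only [F, neg_sq]

/-- Lean junk at `a = 0`: `u²/0² = 0`, the multiplier is `1` and `F_0 = H_0`. [folklore] -/
theorem F_zero : F 0 = deBruijnH 0 := by
  have h : (fun u : ℝ => 1 + u ^ 2 / (0 : ℝ) ^ 2) = fun _ => (1 : ℝ) := by
    funext u; simp
  rw [F, h]
  exact deBruijnHDiv_one'

/-- The crux with a variable threshold `A`: `∀ a ≥ A, ¬ HasOnlyRealZeros F_a`. [folklore] -/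
def NarrowKernelNoGoFrom (A : ℝ) : Prop := ∀ a : ℝ, A ≤ a → ¬ HasOnlyRealZeros (F a)

/-- The crux is the instance `A = 32`. [folklore] -/
theorem crux_iff_from : NarrowKernelNoGo ↔ NarrowKernelNoGoFrom 32 := Iff.rfl

/-- Monotone in the threshold (smaller threshold = stronger statement). [folklore] -/
theorem from_mono {A B : ℝ} (h : A ≤ B) : NarrowKernelNoGoFrom A → NarrowKernelNoGoFrom B :=
  fun hA a ha => hA a (h.trans ha)

/-- The hypothesis dropped altogether: `∀ a : ℝ, ¬ HasOnlyRealZeros F_a`. [folklore] -/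
def NarrowKernelNoGoWithoutThreshold : Prop := ∀ a : ℝ, ¬ HasOnlyRealZeros (F a)

/-- By `F_neg`, dropping the threshold is the same as threshold `0`. [folklore] -/
theorem withoutThreshold_iff_from_zero : NarrowKernelNoGoWithoutThreshold ↔ NarrowKernelNoGoFrom 0 := by
  refine ⟨fun h a _ => h a, fun h a => ?_⟩
  rcases le_or_gt 0 a with ha | ha
  · exact h a ha
  · rw [← F_neg]; exact h (-a) (by linarith)

/-- The `a = 0` instance of the threshold-free variant is `¬ RH` (junk `F_0 = H_0`). [folklore] -/
theorem not_riemannHypothesis_of_from_zero (h : NarrowKernelNoGoFrom 0) : ¬ RiemannHypothesis := by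
  intro hR
  refine h 0 le_rfl ?_
  rw [F_zero]
  exact riemannHypothesis_iff_hasOnlyRealZeros_deBruijnH_zero_holds.1 hR

/-- Threshold `0` = `¬RH` plus GN on the whole Laplace ray. [folklore] -/
theorem from_zero_iff :
    NarrowKernelNoGoFrom 0 ↔ ¬ RiemannHypothesis ∧ ∀ a : ℝ, 0 < a → ¬ HasOnlyRealZeros (F a) := by
  refine ⟨fun h => ⟨not_riemannHypothesis_of_from_zero h, fun a ha => h a ha.le⟩, fun h a ha => ?_⟩
  rcases ha.eq_or_lt with rfl | ha'
  · rw [F_zero]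
    exact fun hH => h.1 (riemannHypothesis_iff_hasOnlyRealZeros_deBruijnH_zero_holds.2 hH)
  · exact h.2 a ha'

/-- **No `_false_without_` theorem exists for the only hypothesis.** The NEGATION of the
threshold-free variant is *equivalent to RH* (unconditionally): refuting the variant proves RH, and
proving it refutes RH. (So `32 ≤ a`, or any positive threshold, is load-bearing only in keeping the
`a = 0` junk instance `¬RH` out; the crux itself is not known to follow from or imply RH.) [folklore] -/
theorem not_withoutThreshold_iff_riemannHypothesis :
    ¬ NarrowKernelNoGoWithoutThreshold ↔ RiemannHypothesis := by
  rw [withoutThreshold_iff_from_zero]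
  constructor
  · intro h
    by_contra hR
    refine h (from_zero_iff.2 ⟨hR, fun a ha hF => hR ?_⟩)
    exact riemannHypothesis_iff_hasOnlyRealZeros_deBruijnH_zero_holds.2
      (Theorems.UniversalFactor.laguerreLift a ha hF)
  · intro hR h
    exact not_riemannHypothesis_of_from_zero h hR

/-- Any positive threshold below 32 gives a formally stronger statement; `A → 0⁺` is GN on the
whole Laplace ray (the conjunction Wide+ExceptionalWide+Medium+Narrow of the route). [folklore] -/
theorem crux_of_from {A : ℝ} (hA : A ≤ 32) (h : NarrowKernelNoGoFrom A) : NarrowKernelNoGo :=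
  crux_iff_from.2 (from_mono hA h)

/-! ## (F) Faithfulness: `F_a ≢ 0`, symmetries of the zero set -/

/-- The Laplace multiplier is `≥ 1`. [folklore] -/
theorem one_le_laplaceMul (a u : ℝ) : 1 ≤ 1 + u ^ 2 / a ^ 2 := by
  have : 0 ≤ u ^ 2 / a ^ 2 := by positivity
  linarith

/-- `Φ/(1 + u²/a²)` is integrable on `(0, ∞)` (dominated by `|Φ| = deBruijnHBound 0 0`). [folklore] -/
theorem integrableOn_phi_div (a : ℝ) :
    IntegrableOn (fun u : ℝ => deBruijnPhi u / (1 + u ^ 2 / a ^ 2)) (Ioi 0) := by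
  have hm : Continuous fun u : ℝ => 1 + u ^ 2 / a ^ 2 := by fun_prop
  have hmeas : AEStronglyMeasurable (fun u : ℝ => deBruijnPhi u / (1 + u ^ 2 / a ^ 2))
      (volume.restrict (Ioi 0)) :=
    ((continuousOn_deBruijnPhi_Ici.mono Ioi_subset_Ici_self).div hm.continuousOn
      fun u _ => (lt_of_lt_of_le one_pos (one_le_laplaceMul a u)).ne').aestronglyMeasurable
      measurableSet_Ioi
  refine (integrableOn_deBruijnHBound 0 0).mono' hmeas
    (ae_restrict_of_forall_mem measurableSet_Ioi fun u _ => ?_)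
  rw [Real.norm_eq_abs, abs_div, deBruijnHBound, zero_mul, zero_mul, Real.exp_zero, one_mul, mul_one,
    abs_of_pos (lt_of_lt_of_le one_pos (one_le_laplaceMul a u))]
  exact div_le_self (abs_nonneg _) (one_le_laplaceMul a u)

/-- `F_a(0) = ∫₀^∞ Φ(u)/(1 + u²/a²) du` (a real number). [folklore] -/
theorem F_apply_zero (a : ℝ) :
    F a 0 = ((∫ u in Ioi (0 : ℝ), deBruijnPhi u / (1 + u ^ 2 / a ^ 2) : ℝ) : ℂ) := by
  rw [F, deBruijnHDiv, ← integral_complex_ofReal]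
  refine setIntegral_congr_fun measurableSet_Ioi fun u _ => ?_
  simp

/-- `F_a(0) > 0`, since `Φ > 0` on `[0, ∞)` (`deBruijnPhi_pos_of_nonneg`). [folklore] -/
theorem F_apply_zero_re_pos (a : ℝ) : 0 < (F a 0).re := by
  rw [F_apply_zero, Complex.ofReal_re]
  have hpos : ∀ u ∈ Ioi (0 : ℝ), 0 < deBruijnPhi u / (1 + u ^ 2 / a ^ 2) := fun u hu =>
    div_pos (deBruijnPhi_pos_of_nonneg (le_of_lt hu)) (lt_of_lt_of_le one_pos (one_le_laplaceMul a u))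
  rw [setIntegral_pos_iff_support_of_nonneg_ae
    (ae_restrict_of_forall_mem measurableSet_Ioi fun u hu => (hpos u hu).le) (integrableOn_phi_div a)]
  have hsub : Ioi (0 : ℝ) ⊆ Function.support (fun u : ℝ => deBruijnPhi u / (1 + u ^ 2 / a ^ 2)) ∩ Ioi 0 :=
    fun u hu => ⟨(hpos u hu).ne', hu⟩
  exact lt_of_lt_of_le (by simp) (measure_mono hsub)

/-- Hence `F_a ≢ 0`: `¬ HasOnlyRealZeros F_a` is never true for the junk reason. [folklore] -/
theorem F_apply_zero_ne_zero (a : ℝ) : F a 0 ≠ 0 := fun h => by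
  have := F_apply_zero_re_pos a
  rw [h, Complex.zero_re] at this
  exact lt_irrefl 0 this

/-- Zeros are symmetric under `z ↦ −z`. [folklore] -/
theorem F_eq_zero_neg_iff (a : ℝ) (z : ℂ) : F a (-z) = 0 ↔ F a z = 0 := by
  rw [F, deBruijnHDiv_neg]

/-- Zeros are symmetric under complex conjugation. [folklore] -/
theorem F_eq_zero_conj_iff (a : ℝ) (z : ℂ) : F a (conj z) = 0 ↔ F a z = 0 := by
  rw [F, ← conj_deBruijnHDiv, map_eq_zero]

/-- A non-real zero may be sought WLOG in the closed first quadrant off the real axis: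
`¬ HasOnlyRealZeros F_a ↔ ∃ z, F_a z = 0 ∧ 0 < Im z ∧ 0 ≤ Re z`. [folklore] -/
theorem not_hasOnlyRealZeros_F_iff (a : ℝ) :
    ¬ HasOnlyRealZeros (F a) ↔ ∃ z : ℂ, F a z = 0 ∧ 0 < z.im ∧ 0 ≤ z.re := by
  constructor
  · intro h
    simp only [HasOnlyRealZeros, not_forall, exists_prop] at h
    obtain ⟨z, hz, him⟩ := h
    -- move to the upper half-plane by conjugation, then to `Re ≥ 0` by `z ↦ -conj z`
    obtain ⟨w, hw, hwim⟩ : ∃ w : ℂ, F a w = 0 ∧ 0 < w.im := by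
      rcases lt_or_gt_of_ne him with hlt | hgt
      · exact ⟨conj z, (F_eq_zero_conj_iff a z).2 hz, by simpa using hlt⟩
      · exact ⟨z, hz, hgt⟩
    rcases le_or_gt 0 w.re with hre | hre
    · exact ⟨w, hw, hwim, hre⟩
    · refine ⟨-conj w, ?_, by simpa using hwim, by simp; linarith⟩
      rw [F_eq_zero_neg_iff, F_eq_zero_conj_iff]; exact hw
  · rintro ⟨z, hz, him, -⟩ h
    exact (ne_of_gt him) (h z hz)

/-! ## (F') No zeros on the imaginary axis: `F_a(iy) > 0` -/

/-- `Φ(u) cosh(yu)/(1 + u²/a²)` is integrable on `(0, ∞)` (dominated by `deBruijnHBound 0 |y|`).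
[folklore] -/
theorem integrableOn_phi_div_mul_cosh (a y : ℝ) :
    IntegrableOn (fun u : ℝ => deBruijnPhi u / (1 + u ^ 2 / a ^ 2) * Real.cosh (y * u)) (Ioi 0) := by
  have hm : Continuous fun u : ℝ => 1 + u ^ 2 / a ^ 2 := by fun_prop
  have hc : Continuous fun u : ℝ => Real.cosh (y * u) := by fun_prop
  have hmeas : AEStronglyMeasurable
      (fun u : ℝ => deBruijnPhi u / (1 + u ^ 2 / a ^ 2) * Real.cosh (y * u)) (volume.restrict (Ioi 0)) :=
    (((continuousOn_deBruijnPhi_Ici.mono Ioi_subset_Ici_self).div hm.continuousOn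
      fun u _ => (lt_of_lt_of_le one_pos (one_le_laplaceMul a u)).ne').mul hc.continuousOn).aestronglyMeasurable
      measurableSet_Ioi
  refine (integrableOn_deBruijnHBound 0 |y|).mono' hmeas
    (ae_restrict_of_forall_mem measurableSet_Ioi fun u hu => ?_)
  have hu : 0 < u := hu
  rw [Real.norm_eq_abs, abs_mul, abs_div, deBruijnHBound, zero_mul, Real.exp_zero, one_mul,
    abs_of_pos (lt_of_lt_of_le one_pos (one_le_laplaceMul a u)), abs_of_pos (Real.cosh_pos _)]
  have h1 : |deBruijnPhi u| / (1 + u ^ 2 / a ^ 2) ≤ |deBruijnPhi u| :=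
    div_le_self (abs_nonneg _) (one_le_laplaceMul a u)
  have h2 : Real.cosh (y * u) ≤ Real.exp (|y| * u) := by
    calc Real.cosh (y * u) ≤ Real.exp |y * u| := Literature.Analysis.Complex.DeBruijn1950.cosh_le_exp_abs _
      _ = Real.exp (|y| * u) := by rw [abs_mul, abs_of_pos hu]
  exact mul_le_mul h1 h2 (Real.cosh_pos _).le (abs_nonneg _)

/-- On the imaginary axis `F_a(iy) = ∫₀^∞ Φ(u) cosh(yu)/(1 + u²/a²) du`, a real number. [folklore] -/
theorem F_apply_I_mul (a y : ℝ) :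
    F a (I * y) = ((∫ u in Ioi (0 : ℝ), deBruijnPhi u / (1 + u ^ 2 / a ^ 2) * Real.cosh (y * u) : ℝ) : ℂ) := by
  rw [F, deBruijnHDiv, ← integral_complex_ofReal]
  refine setIntegral_congr_fun measurableSet_Ioi fun u _ => ?_
  have : Complex.cos (I * (y : ℂ) * (u : ℂ)) = Real.cosh (y * u) := by
    rw [show I * (y : ℂ) * (u : ℂ) = ((y * u : ℝ) : ℂ) * I by push_cast; ring, Complex.cos_mul_I,
      Complex.ofReal_cosh]
  rw [this]
  push_cast
  ring

/-- `F_a(iy) > 0` for all real `y`: `F_a` has NO zeros on the imaginary axis, so (with the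
symmetries) a non-real zero may be sought WLOG in the OPEN first quadrant. [folklore] -/
theorem F_apply_I_mul_re_pos (a y : ℝ) : 0 < (F a (I * y)).re := by
  rw [F_apply_I_mul, Complex.ofReal_re]
  have hpos : ∀ u ∈ Ioi (0 : ℝ), 0 < deBruijnPhi u / (1 + u ^ 2 / a ^ 2) * Real.cosh (y * u) :=
    fun u hu => mul_pos (div_pos (deBruijnPhi_pos_of_nonneg (le_of_lt hu))
      (lt_of_lt_of_le one_pos (one_le_laplaceMul a u))) (Real.cosh_pos _)
  rw [setIntegral_pos_iff_support_of_nonneg_ae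
    (ae_restrict_of_forall_mem measurableSet_Ioi fun u hu => (hpos u hu).le)
    (integrableOn_phi_div_mul_cosh a y)]
  have hsub : Ioi (0 : ℝ) ⊆
      Function.support (fun u : ℝ => deBruijnPhi u / (1 + u ^ 2 / a ^ 2) * Real.cosh (y * u)) ∩ Ioi 0 :=
    fun u hu => ⟨(hpos u hu).ne', hu⟩
  exact lt_of_lt_of_le (by simp) (measure_mono hsub)

/-- No purely imaginary zeros. [folklore] -/
theorem F_apply_I_mul_ne_zero (a y : ℝ) : F a (I * y) ≠ 0 := fun h => by
  have := F_apply_I_mul_re_pos a y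
  rw [h, Complex.zero_re] at this
  exact lt_irrefl 0 this

/-- WLOG the open first quadrant: `¬ HasOnlyRealZeros F_a ↔ ∃ z, F_a z = 0 ∧ 0 < Im z ∧ 0 < Re z`.
[folklore] -/
theorem not_hasOnlyRealZeros_F_iff' (a : ℝ) :
    ¬ HasOnlyRealZeros (F a) ↔ ∃ z : ℂ, F a z = 0 ∧ 0 < z.im ∧ 0 < z.re := by
  rw [not_hasOnlyRealZeros_F_iff]
  refine ⟨fun ⟨z, hz, him, hre⟩ => ⟨z, hz, him, lt_of_le_of_ne hre fun h0 => ?_⟩,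
    fun ⟨z, hz, him, hre⟩ => ⟨z, hz, him, hre.le⟩⟩
  apply F_apply_I_mul_ne_zero a z.im
  rw [← hz]
  congr 1
  apply Complex.ext <;> simp [← h0]

/-! ## (P) Positive helper for the provers' certificate route (travels as evidence only)

Joint continuity of `(a, z) ↦ F_a(z)` away from `a = 0` — the input of every `a`-continuity / Hurwitz
argument on finite windows such as `[32, 54]` (and of `MediumKernelNoGo` on `[π/8, 32]`). At `a = 0` the map
is NOT continuous in `a` (the junk multiplier `1` versus the limit `0`). -/

/-- `(a, z) ↦ F_a(z)` is continuous at every `(a₀, z₀)` with `a₀ ≠ 0` (dominated convergence with the bound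
`|Φ(u)| e^{(|Im z₀|+1)u}`, uniform in `a`). [folklore] -/
theorem continuousAt_F_uncurry {p₀ : ℝ × ℂ} (h₀ : p₀.1 ≠ 0) :
    ContinuousAt (fun p : ℝ × ℂ => F p.1 p.2) p₀ := by
  change ContinuousAt (fun p : ℝ × ℂ => ∫ u in Ioi (0 : ℝ),
    ((deBruijnPhi u / (1 + u ^ 2 / p.1 ^ 2) : ℝ) : ℂ) * Complex.cos (p.2 * u)) p₀
  refine continuousAt_of_dominated (bound := deBruijnHBound 0 (|p₀.2.im| + 1))
    (Filter.Eventually.of_forall fun p =>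
      ((isDivAdmissible_laplace p.1).integrableOn_deBruijnHDiv p.2).aestronglyMeasurable) ?_
    (integrableOn_deBruijnHBound _ _) ?_
  · filter_upwards [Metric.ball_mem_nhds p₀ one_pos] with p hp
    refine ae_restrict_of_forall_mem measurableSet_Ioi fun u hu => ?_
    have hu' : 0 < u := hu
    rw [← ball_prod_same, Set.mem_prod] at hp
    rw [norm_mul, Complex.norm_real, Real.norm_eq_abs, deBruijnHBound, zero_mul, Real.exp_zero, one_mul,
      abs_div, abs_of_pos (lt_of_lt_of_le one_pos (one_le_laplaceMul p.1 u))]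
    exact mul_le_mul (div_le_self (abs_nonneg _) (one_le_laplaceMul p.1 u))
      (norm_cos_mul_le_exp (abs_im_le_of_mem_ball hp.2) hu'.le) (norm_nonneg _) (abs_nonneg _)
  · refine Filter.Eventually.of_forall fun u => ?_
    have hm : ContinuousAt (fun a : ℝ => 1 + u ^ 2 / a ^ 2) p₀.1 :=
      continuousAt_const.add (continuousAt_const.div (continuousAt_id.pow 2) (pow_ne_zero 2 h₀))
    have hq : ContinuousAt (fun a : ℝ => deBruijnPhi u / (1 + u ^ 2 / a ^ 2)) p₀.1 :=
      continuousAt_const.div hm (lt_of_lt_of_le one_pos (one_le_laplaceMul p₀.1 u)).ne'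
    have h1 : ContinuousAt (fun p : ℝ × ℂ => ((deBruijnPhi u / (1 + u ^ 2 / p.1 ^ 2) : ℝ) : ℂ)) p₀ :=
      Complex.continuous_ofReal.continuousAt.comp (hq.comp continuousAt_fst)
    have h2 : Continuous fun p : ℝ × ℂ => Complex.cos (p.2 * (u : ℂ)) := by fun_prop
    exact h1.mul h2.continuousAt

/-- Continuity on `{a ≠ 0} × ℂ`. [folklore] -/
theorem continuousOn_F_uncurry :
    ContinuousOn (fun p : ℝ × ℂ => F p.1 p.2) ({a : ℝ | a ≠ 0} ×ˢ Set.univ) :=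
  fun _ hp => (continuousAt_F_uncurry hp.1).continuousWithinAt

/-- In particular `a ↦ F_a(z)` is continuous on `a ≠ 0` for each fixed `z`. [folklore] -/
theorem continuousOn_F_param (z : ℂ) : ContinuousOn (fun a : ℝ => F a z) {a : ℝ | a ≠ 0} := by
  intro a ha
  have h1 : ContinuousAt (fun p : ℝ × ℂ => F p.1 p.2) (a, z) := continuousAt_F_uncurry ha
  have h2 : ContinuousAt (fun x : ℝ => (x, z)) a := (continuous_id.prodMk continuous_const).continuousAt
  exact (h1.comp_of_eq h2 rfl).continuousWithinAt

/-! ## (N) Near-misses (the only `sorry`s of this file) -/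

/-- **Near-miss (numerically certain, not certified): the crux at its left end-point `a = 32`.**
WITNESS: `F_32(z₀) = 0` at `z₀ ≈ 14010.163428 + 0.022965 i` (numerics (N1): Laplace(32)-smoothing,
standard deviation `√2/32 = 0.0442` in `x = 2t`, fills the Z-bump `+3.967e-3` between Lehmer's zeros
`2γ = 14010.12573/14010.20113`; threshold `a* = 37.473`). A Lean proof needs an interval certificate for
`F_32/B` on a box around `z₀`, e.g. `[14010.05, 14010.28] × [0.010, 0.045]` (argument principle, winding
number 1; `B(t) = (1/16)(t²+1/4)π^{-1/4}|Γ(1/4+it/2)|` removes the scale `10^{-2390}`), i.e. exactly the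
technology of item `LehmerPointNoGo` (`a = 16`, zero at `14010.163404 + 0.079745 i`) run at `a = 32`; OR,
cheaper (N4): the one-point real-axis certificate `L₁(x_d) = (F')² − a²F² + a²F·H_0 < 0` at
`x_d = 14010.1635` (numerically `−8.17e-3·B²`, forty times its own `(F')²` term), given the lemma
"LP(F_a) ⇒ L₁ ≥ 0 on ℝ". OBSTRUCTION to closing it here: no certified evaluation of ξ (and of the two real
quadratures `F_a = E[H_0(·+Y)]`, `F_a'`) at height 7005 in the tree. [cite: CsordasSmithVarga1994] -/
theorem crux_at_32 : ¬ HasOnlyRealZeros (F 32) := by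
  sorry

/-- **Near-miss: the finite window `32 ≤ a ≤ 54` is a certified computation, not research.**
By (N1)–(N2) every `a ∈ [32, 54.7)` has a close pair of zeros of Ξ below `t = 6·10⁴` whose Z-bump is
filled by Laplace(a)-smoothing (quadratic model `a < √2/γ-gap`, verified beyond the model at Lehmer's pair:
`a* = 37.473` vs `37.514`); the single pair `γ = 57273.661932/57273.687771` (gap 0.0258393) serves all of
it. `F_a(z)` is analytic in `(a, z)` (`a ≠ 0`), so finitely many `a`-interval boxes + argument principle
close this window exactly as `MediumKernelNoGo` plans for `[π/8, 32]`. What is NOT reachable this way is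
`a → ∞`: the lowest witness for `a` lives at height `T(a)` with `N(T)(log T/a)³ ≍ 1` (GUE heuristics),
so `∀ a ≥ 32` needs the asymptotic band-limit argument (mechanism confirmed numerically in (N3), onset
`a/L ≲ 3`, `L = ¼ log(t/2π)`) or an RH-conditional small-gap theorem WITH neighbour control at
normalised gap `< √2 log(T/2π)/(2πa)` — the known `lim inf ≤ 0.5155` (RH) has neither the margin nor the
neighbours (WLOG RH is legitimate: `crux_iff_rh_imp`). [cite: Dobner2021] -/
theorem crux_on_pair_window : ∀ a : ℝ, 32 ≤ a → a ≤ 54 → ¬ HasOnlyRealZeros (F a) := by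
  sorry

/-! ## Targets (lead's stuck stubs): none filed yet (payload.stuck_stubs = []). -/

end Summit.RiemannHypothesis.RiemannHypothesis.Cruxes.NarrowKernelNoGo.Disproof
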